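import Summits.BirchSwinnertonDyer.BirchSwinnertonDyer.Theorems.UniversalToricDescentToricKernelAtThreeApZeroOddDefectPTTROfPrint
import HarnessLib

/-!
# Route `UniversalToricDescent` — the cross-squeeze and the pointwise kernel in the DEGREE-ONLY twin currency
# (crux idea `degree-only-twin-clause`, utd-idea g25, T10; first half of the TURNKEY kernel⁵)

Cell `bsd-wall`, width seat `bsd-wall-utd-p2-w2` (prover g6, 2026-08-28); `--supports stmt-BirchSwinnertonDyer-27401`
(♭B′ `TwinWanFrameAtThreeMultTresT`; equally ♭C₀_T 27173). The UTD pen (pss3x g5, STATUS 13:48:45Z) adopts the weaker re-typing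
♭B′° only given «a sorry-free kernel-from-♭B′° closer (turnkey, like CloserR)»; this file and its sibling
`UniversalToricDescentToricKernelAtThreeDegreeOnlyTwinOfPrint` ARE that closer. The degree clause is spelled in the route's OWN
profile vocabulary (no new definition):

  «`X^∅_ac(W′; 𝔭′)` torsion → ∀ g n m, `Ch·R₀⟦T⟧ = (g)` → (g has first unit coefficient at n) → (L′ has first unit
   coefficient at m) → m ≤ n»,  a profile being `(∀ i < a, ‖coeff i F‖ < 1) ∧ ‖coeff a F‖ = 1` as displayed in ♭T′ 26975 —

the δ-unfolding of the card's `DegreeClause (Ch·R₀⟦T⟧) L′` / `FirstUnitIndex` (Sketch-utd-idea-g25.lean §1–§2), so items typed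
with those words are served by `exact`.

## What this file proves (theorems only; every hypothesis displayed; no definition, no named fact, no `sorry`)

* §0 algebra: the rational Wan clause `∃ k, 3^k·I ⊆ (L)` implies the degree clause; so does an equality `I = (L)`.
* §1 `charIdeal_eq_of_defectPT_of_wall_of_mu_degreeConditional` — the cross-squeeze ♭T′ 26975 → wall 20395 → μ 20400 of
  `UniversalToricDescentDefectPTSqueeze.charIdeal_eq_of_defectPT_of_wall_of_mu_torsionConditional` (w2 g3) with the twin's clause
  WEAKENED to the degree clause: its step `h₂ : m′ ≤ n′` is now the hypothesis itself (utd-idea g25 §4 `squeeze_of_wall_of_degreeClause`,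
  threaded through the real binders); `twinLambda_eq_of_defectPT_of_wall_degreeConditional` — bonus: the twin's λ-EQUALITY
  `n′ = m′` for every unit-profile generator / index pair (the degree road's native output; no ideal equality claimed).
* §2 `bsdp_three_of_twinDegreeFrameAt_odd_of_defectPT` — the pointwise kernel
  `UniversalToricDescentKernelDefectPTOfPrint.bsdp_three_of_twinWanFrameAtT_odd_of_defectPT` (w2 g3 ← p609468 utd-p1 g11) VERBATIM
  except that the pointwise twin `hI'` owes the DEGREE clause (under torsion) and `heq` comes from §1.

HONEST FRAMING: CONDITIONAL on every displayed hypothesis (♭T′ 26975 research, 20395 THE WALL; the degree clause is research for a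
universal supplier exactly as ♭ is); nothing here closes an item; BSD is proved for no curve by this file; std axioms only.
References: [GreenbergVatsal2000] Thm. (1.4); [JetchevSkinnerWan2017] §7.4.1; [FriedbergHoffstein1995] Thm. B.
-/

noncomputable section

open scoped Classical

set_option linter.dupNamespace false
set_option autoImplicit false


namespace Summit.BirchSwinnertonDyer.BirchSwinnertonDyer.Theorems.UniversalToricDescentKernelDegreeOnlyTwin

open WeierstrassCurve NumberField IsDedekindDomain Field
  Literature.NumberTheory.EllipticCurves
  Literature.NumberTheory.EllipticCurves.ModularForms
  Literature.NumberTheory.EllipticCurves.Rank1Residual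
  Literature.NumberTheory.EllipticCurves.KrizLi2019
  Literature.NumberTheory.EllipticCurves.LiuZhangZhang2018
  Summit.BirchSwinnertonDyer.Rank1Residual
  Summit.BirchSwinnertonDyer.Rank1Residual.Additive
  Summit.BirchSwinnertonDyer.Rank1Residual.X11b
  Summit.BirchSwinnertonDyer.Rank1Residual.X11b.AcSelmer
  Summit.BirchSwinnertonDyer.Rank1Residual.X11b.Halves
  Summit.BirchSwinnertonDyer.BirchSwinnertonDyer.Theses.UniversalToricDescent
  Summit.BirchSwinnertonDyer.BirchSwinnertonDyer.Theorems
  Summit.BirchSwinnertonDyer.BirchSwinnertonDyer.Theorems.UniversalToricDescentTwinChoice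
  Summit.BirchSwinnertonDyer.BirchSwinnertonDyer.Theorems.UniversalToricDescentWaldspurgerFlat
  Summit.BirchSwinnertonDyer.BirchSwinnertonDyer.Theorems.UniversalToricDescentKernelOdd
  Summit.BirchSwinnertonDyer.BirchSwinnertonDyer.Theorems.UniversalToricDescentKernelOfPrint
  Summit.BirchSwinnertonDyer.BirchSwinnertonDyer.Theorems.UniversalToricDescentKernelFlatOfPrint
  Summit.BirchSwinnertonDyer.BirchSwinnertonDyer.Theorems.UniversalToricDescentActDFlatGlue
  Summit.BirchSwinnertonDyer.BirchSwinnertonDyer.Theorems.UniversalToricDescentNormProfile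
  Summit.BirchSwinnertonDyer.BirchSwinnertonDyer.Theorems.UniversalToricDescentDefectTransport
  Summit.BirchSwinnertonDyer.BirchSwinnertonDyer.Theorems.UniversalToricDescentDefectPTSqueeze
  Summit.BirchSwinnertonDyer.BirchSwinnertonDyer.Theorems.UniversalToricDescentKernelDefectPTOfPrint
  Summit.BirchSwinnertonDyer.BirchSwinnertonDyer.Theorems.UniversalToricDescentKernelDefectPTTROfPrint

/-! ### §0 Algebra of the degree clause over `R₀⟦T⟧` -/

/-- The rational Wan clause `∃ k, ∀ G ∈ I, 3^k·G ∈ (L)` implies the DEGREE clause «every unit-profile generator `g` of `I`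
has profile index ≥ that of `L`»: `L ∣ g` by `dvd_of_mem_of_C_pow_mul_mem_span` (cancelling `3^k` against `μ(L) = 0`), then
`firstUnitCoeff_le_of_dvd`. (= utd-idea g25 Sketch §3 `degreeClause_of_wanClause`, words unfolded.) [folklore] -/
theorem degreeClause_of_wanClause {I : Ideal (UnrSeries 3)} {L : UnrSeries 3}
    (hk : ∃ k : ℕ, ∀ G ∈ I, PowerSeries.C (((3 : ℕ) : unrIntegers 3) ^ k) * G ∈ Ideal.span {L}) :
    ∀ (g : UnrSeries 3) (n m : ℕ), I = Ideal.span {g} →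
      (∀ i < n, ‖((PowerSeries.coeff i g : unrIntegers 3) : ℂ_[3])‖ < 1) ∧
          ‖((PowerSeries.coeff n g : unrIntegers 3) : ℂ_[3])‖ = 1 →
      (∀ i < m, ‖((PowerSeries.coeff i L : unrIntegers 3) : ℂ_[3])‖ < 1) ∧
          ‖((PowerSeries.coeff m L : unrIntegers 3) : ℂ_[3])‖ = 1 →
      m ≤ n := by
  intro g n m hI hg hL
  have hg_mem : g ∈ I := hI ▸ Ideal.mem_span_singleton_self g
  have hLg : L ∣ g := dvd_of_mem_of_C_pow_mul_mem_span hL.1 hL.2 hk hg_mem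
  exact firstUnitCoeff_le_of_dvd hLg hL.1 hg.2

/-- An EQUALITY `I = (L)` (e.g. Yan–Zhu's main conjecture for a good-ordinary twin) implies the degree clause (Wan clause
with `k = 0`, then §0). [folklore] -/
theorem degreeClause_of_eq_span {I : Ideal (UnrSeries 3)} {L : UnrSeries 3} (hI : I = Ideal.span {L}) :
    ∀ (g : UnrSeries 3) (n m : ℕ), I = Ideal.span {g} →
      (∀ i < n, ‖((PowerSeries.coeff i g : unrIntegers 3) : ℂ_[3])‖ < 1) ∧
          ‖((PowerSeries.coeff n g : unrIntegers 3) : ℂ_[3])‖ = 1 →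
      (∀ i < m, ‖((PowerSeries.coeff i L : unrIntegers 3) : ℂ_[3])‖ < 1) ∧
          ‖((PowerSeries.coeff m L : unrIntegers 3) : ℂ_[3])‖ = 1 →
      m ≤ n := by
  refine degreeClause_of_wanClause ⟨0, fun G hG ↦ ?_⟩
  rw [hI] at hG
  simpa using hG

section Squeeze

variable (W : WeierstrassCurve ℚ) [W.IsElliptic] [W.IsGloballyMinimal] (W' : WeierstrassCurve ℚ) [W'.IsElliptic]
  [W'.IsGloballyMinimal] (N N' : ℕ) [NeZero N] [NeZero N'] (K : Type) [Field K] [NumberField K]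
  (Dt : ModularParametrizationData W N) (Dt' : ModularParametrizationData W' N')

/-! ### §1 The squeeze on ♭T′ → wall → μ with a DEGREE-conditional twin clause -/

/-- **The cross-squeeze on ♭T′ `DefectTransportModThreePT` (26975) → wall 20395 → μ 20400, DEGREE currency.** At the `E`-frame
`L` (PT facts, wild base finiteness `hfinE`, `X^∅_ac(E)` torsion `htors` displayed) and a handed twin frame `L′` owing ONLY the
degree clause, and only under torsion of `X^∅_ac(W′)`: `Ch(E)·R₀⟦T⟧ = (L)`. Steps: wall `(L) ⊆ (g)` ⟹ `n ≤ m`; ♭T′ at `(L, L′)`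
returns `(g, g′, n, m, n′, m′)` with `n + m′ = n′ + m`; p611201 ⟹ `X^∅_ac(W′)` torsion ⟹ the degree clause at `(g′, n′, m′)` IS
`m′ ≤ n′`; `squeeze` ⟹ `n = m` ⟹ `eq_span_of_span_le_of_normProfile`. The only line that differs from the torsion-conditional
squeeze of `UniversalToricDescentDefectPTSqueeze` is `h₂`. CONDITIONAL on the three displayed route items.
[cite: GreenbergVatsal2000, Thm. (1.4)] [cite: JetchevSkinnerWan2017, §7.4.1] -/
theorem charIdeal_eq_of_defectPT_of_wall_of_mu_degreeConditional (hD : DefectTransportModThreePT)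
    (hwall : AdditiveSplitIMCInclusionAtThree) (hmu : TwinMuZeroAtThree)
    (hPT : PoitouTateSelmerStructureDualityFact) (hPT2 : PoitouTateShaTateDualFact)
    (hO6 : Additive.ClassO6 W 3) (hsurj : W.HasSurjectiveModNGaloisRep 3) (hr : W.analyticRank = 1)
    (hN : W.conductorNorm ℤ = N) (hcong : O6.ModPCongruent W' W 3) (hss : ¬ Addv W' 3) (hN' : W'.conductorNorm ℤ = N')
    (hK : IsImaginaryQuadratic K) (hHN : SatisfiesHeegnerHypothesis N K) (hHN' : SatisfiesHeegnerHypothesis N' K)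
    (hfinE : ∀ (v : HeightOneSpectrum (𝓞 K)), ((3 : ℕ) : 𝓞 K) ∈ v.asIdeal → Finite (selmerAcBase (W.baseChange K) 3 v ∅))
    (κ : ZpExtension K 3) (hκ : κ.IsAnticyclotomic) (γ : absoluteGaloisGroup K) [Fact (κ.IsTopGenerator γ)]
    (𝔭 : HeightOneSpectrum (𝓞 K)) (h𝔭 : ((3 : ℕ) : 𝓞 K) ∈ 𝔭.asIdeal) (he : 𝔭.asIdeal.ramificationIdx (𝓞 ℚ) = 1)
    (hf : 𝔭.asIdeal.inertiaDeg (𝓞 ℚ) = 1) (𝔭' : HeightOneSpectrum (𝓞 K)) (h𝔭' : ((3 : ℕ) : 𝓞 K) ∈ 𝔭'.asIdeal)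
    (hne : 𝔭' ≠ 𝔭) (ι' : PadicAlgCl 3 ≃+* ℂ) (hind : SchneiderFree.BranchInducesPrime 3 ι' 𝔭)
    (htors : Module.IsTorsion (IwasawaAlgebra 3) (XAc (W.baseChange K) 3 κ 𝔭' ∅ γ))
    (hdeg : ∃ (ΩK' : ℂ) (Ωp' : ℂ_[3]) (L' : UnrSeries 3), ΩK' ≠ 0 ∧ Ωp' ≠ 0 ∧ IsBDPLFunction ι' 𝔭 κ γ Dt'.f ΩK' Ωp' L' ∧
      (Module.IsTorsion (IwasawaAlgebra 3) (XAc (W'.baseChange K) 3 κ 𝔭' ∅ γ) →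
        ∀ (g : UnrSeries 3) (n m : ℕ),
          (XAc.charIdeal (W'.baseChange K) 3 κ 𝔭' ∅ γ).map (PowerSeries.map (toUnr 3)) = Ideal.span {g} →
          (∀ i < n, ‖((PowerSeries.coeff i g : unrIntegers 3) : ℂ_[3])‖ < 1) ∧
              ‖((PowerSeries.coeff n g : unrIntegers 3) : ℂ_[3])‖ = 1 →
          (∀ i < m, ‖((PowerSeries.coeff i L' : unrIntegers 3) : ℂ_[3])‖ < 1) ∧
              ‖((PowerSeries.coeff m L' : unrIntegers 3) : ℂ_[3])‖ = 1 →
          m ≤ n))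
    {ΩK : ℂ} {Ωp : ℂ_[3]} {L : UnrSeries 3} (hΩK : ΩK ≠ 0) (hΩp : Ωp ≠ 0)
    (hBDP : IsBDPLFunction ι' 𝔭 κ γ Dt.f ΩK Ωp L) :
    (XAc.charIdeal (W.baseChange K) 3 κ 𝔭' ∅ γ).map (PowerSeries.map (toUnr 3)) = Ideal.span {L} := by
  -- adapted from `charIdeal_eq_of_defectPT_of_wall_of_mu_torsionConditional` (w2 g3); the one changed step is marked
  have hle : Ideal.span {L} ≤ (XAc.charIdeal (W.baseChange K) 3 κ 𝔭' ∅ γ).map (PowerSeries.map (toUnr 3)) :=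
    hwall W N K Dt hO6 hsurj hr hN hK hHN κ hκ γ 𝔭 h𝔭 he hf 𝔭' h𝔭' hne ι' hind ΩK Ωp L hΩK hΩp hBDP
  obtain ⟨ΩK', Ωp', L', hΩK', hΩp', hBDP', hdegT⟩ := hdeg
  have hi' : ∃ i : ℕ, ‖((PowerSeries.coeff i L' : unrIntegers 3) : ℂ_[3])‖ = 1 :=
    hmu W W' N N' K Dt Dt' hO6 hsurj hr hN hcong hss hN' hK hHN hHN' κ hκ γ 𝔭 h𝔭 he hf 𝔭' h𝔭' hne ι' hind ΩK' Ωp' L'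
      hΩK' hΩp' hBDP'
  obtain ⟨g, g', n, m, n', m', hIE, hI', hg, hL, hg', hL', hsum⟩ :=
    hD hPT hPT2 W W' N N' K Dt Dt' hO6 hsurj hr hN hcong hss hN' hK hHN hHN' hfinE κ hκ γ 𝔭 𝔭' h𝔭 he hf h𝔭' hne ι'
      hind htors ΩK Ωp L hΩK hΩp hBDP hle ΩK' Ωp' L' hΩK' hΩp' hBDP' hi'
  have htors' : Module.IsTorsion (IwasawaAlgebra 3) (XAc (W'.baseChange K) 3 κ 𝔭' ∅ γ) :=
    (defectTransport_torsionMu_of_wall W W' K hN hcong hN' hK hHN hHN' κ hκ γ h𝔭' htors hle ⟨m, hL.2⟩).2.2.1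
  have hgL : g ∣ L := by
    rw [hIE] at hle
    exact Ideal.mem_span_singleton.mp (hle (Ideal.mem_span_singleton_self L))
  have h₁ : n ≤ m := firstUnitCoeff_le_of_dvd hgL hg.1 hL.2
  -- CHANGED: `h₂` is the degree clause itself, evaluated at ♭T′'s generator and indices
  have h₂ : m' ≤ n' := hdegT htors' g' n' m' hI' hg' hL'
  have hnm : n = m := by omega
  subst hnm
  exact eq_span_of_span_le_of_normProfile hIE hle hg.1 hL.2

/-- **Bonus — the twin's λ-EQUALITY, degree currency.** Under ♭T′ + wall and ONE `E`-frame `L`, a twin frame `L′` with a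
displayed profile index `m′` (so `μ(L′) = 0` is in hand; 20400 not needed) owing only the degree clause (under torsion) has, for EVERY unit-profile generator `g′` of `Ch(W′)·R₀⟦T⟧` and every pair of profile
indices `(n′, m′)` of `(g′, L′)`, `n′ = m′` (`λ_alg(W′) = λ_an(W′)`: the same squeeze read on the twin's side; the ideal
equality `Ch(W′)·R₀⟦T⟧ = (L′)` is NOT claimed — the degree road forgets root positions). CONDITIONAL; closes nothing.
[cite: GreenbergVatsal2000, Thm. (1.4)] -/
theorem twinLambda_eq_of_defectPT_of_wall_degreeConditional (hD : DefectTransportModThreePT)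
    (hwall : AdditiveSplitIMCInclusionAtThree)
    (hPT : PoitouTateSelmerStructureDualityFact) (hPT2 : PoitouTateShaTateDualFact)
    (hO6 : Additive.ClassO6 W 3) (hsurj : W.HasSurjectiveModNGaloisRep 3) (hr : W.analyticRank = 1)
    (hN : W.conductorNorm ℤ = N) (hcong : O6.ModPCongruent W' W 3) (hss : ¬ Addv W' 3) (hN' : W'.conductorNorm ℤ = N')
    (hK : IsImaginaryQuadratic K) (hHN : SatisfiesHeegnerHypothesis N K) (hHN' : SatisfiesHeegnerHypothesis N' K)
    (hfinE : ∀ (v : HeightOneSpectrum (𝓞 K)), ((3 : ℕ) : 𝓞 K) ∈ v.asIdeal → Finite (selmerAcBase (W.baseChange K) 3 v ∅))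
    (κ : ZpExtension K 3) (hκ : κ.IsAnticyclotomic) (γ : absoluteGaloisGroup K) [Fact (κ.IsTopGenerator γ)]
    (𝔭 : HeightOneSpectrum (𝓞 K)) (h𝔭 : ((3 : ℕ) : 𝓞 K) ∈ 𝔭.asIdeal) (he : 𝔭.asIdeal.ramificationIdx (𝓞 ℚ) = 1)
    (hf : 𝔭.asIdeal.inertiaDeg (𝓞 ℚ) = 1) (𝔭' : HeightOneSpectrum (𝓞 K)) (h𝔭' : ((3 : ℕ) : 𝓞 K) ∈ 𝔭'.asIdeal)
    (hne : 𝔭' ≠ 𝔭) (ι' : PadicAlgCl 3 ≃+* ℂ) (hind : SchneiderFree.BranchInducesPrime 3 ι' 𝔭)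
    (htors : Module.IsTorsion (IwasawaAlgebra 3) (XAc (W.baseChange K) 3 κ 𝔭' ∅ γ))
    {ΩK : ℂ} {Ωp : ℂ_[3]} {L : UnrSeries 3} (hΩK : ΩK ≠ 0) (hΩp : Ωp ≠ 0)
    (hBDP : IsBDPLFunction ι' 𝔭 κ γ Dt.f ΩK Ωp L)
    {ΩK' : ℂ} {Ωp' : ℂ_[3]} {L' : UnrSeries 3} (hΩK' : ΩK' ≠ 0) (hΩp' : Ωp' ≠ 0)
    (hBDP' : IsBDPLFunction ι' 𝔭 κ γ Dt'.f ΩK' Ωp' L')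
    (hdegT : Module.IsTorsion (IwasawaAlgebra 3) (XAc (W'.baseChange K) 3 κ 𝔭' ∅ γ) →
      ∀ (g : UnrSeries 3) (n m : ℕ),
        (XAc.charIdeal (W'.baseChange K) 3 κ 𝔭' ∅ γ).map (PowerSeries.map (toUnr 3)) = Ideal.span {g} →
        (∀ i < n, ‖((PowerSeries.coeff i g : unrIntegers 3) : ℂ_[3])‖ < 1) ∧
            ‖((PowerSeries.coeff n g : unrIntegers 3) : ℂ_[3])‖ = 1 →
        (∀ i < m, ‖((PowerSeries.coeff i L' : unrIntegers 3) : ℂ_[3])‖ < 1) ∧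
            ‖((PowerSeries.coeff m L' : unrIntegers 3) : ℂ_[3])‖ = 1 →
        m ≤ n)
    {g' : UnrSeries 3} {n' m' : ℕ}
    (hI' : (XAc.charIdeal (W'.baseChange K) 3 κ 𝔭' ∅ γ).map (PowerSeries.map (toUnr 3)) = Ideal.span {g'})
    (hg' : (∀ i < n', ‖((PowerSeries.coeff i g' : unrIntegers 3) : ℂ_[3])‖ < 1) ∧
      ‖((PowerSeries.coeff n' g' : unrIntegers 3) : ℂ_[3])‖ = 1)
    (hL' : (∀ i < m', ‖((PowerSeries.coeff i L' : unrIntegers 3) : ℂ_[3])‖ < 1) ∧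
      ‖((PowerSeries.coeff m' L' : unrIntegers 3) : ℂ_[3])‖ = 1) :
    n' = m' := by
  have hle : Ideal.span {L} ≤ (XAc.charIdeal (W.baseChange K) 3 κ 𝔭' ∅ γ).map (PowerSeries.map (toUnr 3)) :=
    hwall W N K Dt hO6 hsurj hr hN hK hHN κ hκ γ 𝔭 h𝔭 he hf 𝔭' h𝔭' hne ι' hind ΩK Ωp L hΩK hΩp hBDP
  have hi' : ∃ i : ℕ, ‖((PowerSeries.coeff i L' : unrIntegers 3) : ℂ_[3])‖ = 1 := ⟨m', hL'.2⟩
  obtain ⟨g₁, g₁', n₁, m₁, n₁', m₁', hIE, hI₁', hg₁, hL₁, hg₁', hL₁', hsum⟩ :=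
    hD hPT hPT2 W W' N N' K Dt Dt' hO6 hsurj hr hN hcong hss hN' hK hHN hHN' hfinE κ hκ γ 𝔭 𝔭' h𝔭 he hf h𝔭' hne ι'
      hind htors ΩK Ωp L hΩK hΩp hBDP hle ΩK' Ωp' L' hΩK' hΩp' hBDP' hi'
  have htors' : Module.IsTorsion (IwasawaAlgebra 3) (XAc (W'.baseChange K) 3 κ 𝔭' ∅ γ) :=
    (defectTransport_torsionMu_of_wall W W' K hN hcong hN' hK hHN hHN' κ hκ γ h𝔭' htors hle ⟨m₁, hL₁.2⟩).2.2.1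
  have hgL : g₁ ∣ L := by
    rw [hIE] at hle
    exact Ideal.mem_span_singleton.mp (hle (Ideal.mem_span_singleton_self L))
  have h₁ : n₁ ≤ m₁ := firstUnitCoeff_le_of_dvd hgL hg₁.1 hL₁.2
  have h₂ : m₁' ≤ n₁' := hdegT htors' g₁' n₁' m₁' hI₁' hg₁' hL₁'
  have hnm' : n₁' = m₁' := by omega
  -- transfer ♭T′'s indices `(n₁′, m₁′)` to the displayed ones `(n′, m′)`: profile indices are unique, and two unit-profile
  -- generators of the same principal ideal have the same index (each divides the other)
  have hmm : m₁' = m' := by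
    rcases Nat.lt_trichotomy m₁' m' with h | h | h
    · exact absurd hL₁'.2 (ne_of_lt (hL'.1 _ h))
    · exact h
    · exact absurd hL'.2 (ne_of_lt (hL₁'.1 _ h))
  have hg'g₁' : g' ∣ g₁' := by
    have : g₁' ∈ Ideal.span {g'} := hI' ▸ (hI₁' ▸ Ideal.mem_span_singleton_self g₁')
    exact Ideal.mem_span_singleton.mp this
  have hg₁'g' : g₁' ∣ g' := by
    have : g' ∈ Ideal.span {g₁'} := hI₁' ▸ (hI' ▸ Ideal.mem_span_singleton_self g')
    exact Ideal.mem_span_singleton.mp this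
  have hnn : n₁' = n' :=
    le_antisymm (firstUnitCoeff_le_of_dvd hg₁'g' hg₁'.1 hg'.2) (firstUnitCoeff_le_of_dvd hg'g₁' hg'.1 hg₁'.2)
  omega

end Squeeze

/-! ### §2 The pointwise kernel on ♭T′ → wall → μ with a DEGREE-conditional pointwise twin -/

/-- **Pointwise kernel, DEGREE-CONDITIONAL twin** = `UniversalToricDescentKernelDefectPTOfPrint.bsdp_three_of_twinWanFrameAtT_odd_of_defectPT`
(p-file of w2 g3; itself p609468 §1 of utd-p1 g11 re-threaded) with the pointwise twin `hI'` owing, at every frame datum, ONE BDP frame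
`L′` and — only under torsion of `X^∅_ac(W′; 𝔭′)` — the DEGREE clause; the IMC equality for `E` at `L` now comes from §1. Everything
else (Friedberg–Hoffstein choice of `K`, Gross–Zagier–Kolyvagin rank-one data, V♯ value, additive control, wild base finiteness
act E, index bounds, exact-index BSD₃ reading) VERBATIM. CONDITIONAL on every displayed hypothesis; BSD is proved for no curve by
this. [cite: JetchevSkinnerWan2017, §7.4.1] [cite: FriedbergHoffstein1995, Thm. B] [cite: GreenbergVatsal2000, Thm. (1.4)] -/
theorem bsdp_three_of_twinDegreeFrameAt_odd_of_defectPT (hF : ToricPublishedInputs)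
    (hD : DefectTransportModThreePT) (hwall : AdditiveSplitIMCInclusionAtThree) (hmu : TwinMuZeroAtThree)
    (hPT : PoitouTateSelmerStructureDualityFact) (hPT2 : PoitouTateShaTateDualFact)
    (hV : ∀ (W : WeierstrassCurve ℚ) [W.IsElliptic] [W.IsGloballyMinimal] (N : ℕ) [NeZero N] (K : Type)
      [Field K] [NumberField K] (Dt : ModularParametrizationData W N) (H : HeegnerDatum N (NumberField.discr K))
      (ι : K →+* ℂ) (P : (W.baseChange K).toAffine.Point),
      Additive.ClassO6 W 3 → W.HasSurjectiveModNGaloisRep 3 → W.analyticRank = 1 → W.conductorNorm ℤ = N →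
      IsImaginaryQuadratic K → SatisfiesHeegnerHypothesis N K → Odd (NumberField.discr K) →
      (W.quadraticTwist (NumberField.discr K : ℚ)).entireLFunction 1 ≠ 0 →
      (WeierstrassCurve.Affine.Point.map ι.toRatAlgHom) P = heegnerPointComplex Dt H → ¬ IsOfFinAddOrder P →
      ∀ (κ : ZpExtension K 3), κ.IsAnticyclotomic → ∀ (γ : absoluteGaloisGroup K) [Fact (κ.IsTopGenerator γ)]
        (𝔭 : HeightOneSpectrum (𝓞 K)) (h𝔭 : ((3 : ℕ) : 𝓞 K) ∈ 𝔭.asIdeal)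
        (he : 𝔭.asIdeal.ramificationIdx (𝓞 ℚ) = 1) (hf : 𝔭.asIdeal.inertiaDeg (𝓞 ℚ) = 1),
        ∃ ι' : PadicAlgCl 3 ≃+* ℂ, SchneiderFree.BranchInducesPrime 3 ι' 𝔭 ∧
          ∃ (ΩK : ℂ) (Ωp : ℂ_[3]) (L : UnrSeries 3), ΩK ≠ 0 ∧ Ωp ≠ 0 ∧ IsBDPLFunction ι' 𝔭 κ γ Dt.f ΩK Ωp L ∧
            ∃ u : (unrIntegers 3)ˣ, L.HasValueAt 0 ((((u : unrIntegers 3) : unrIntegers 3) : ℂ_[3]) *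
              (algebraMap ℚ_[3] ℂ_[3] (logOmega W 3 (embAt K 3 𝔭 h𝔭 he hf) P / (Dt.c : ℚ_[3]))) ^ 2))
    (hC : WildSplitControlAtThree) (hZ : WildRankZeroTwistAtThree)
    (W : WeierstrassCurve ℚ) [W.IsElliptic] [W.IsGloballyMinimal]
    (hO6 : Additive.ClassO6 W 3) (hr : W.analyticRank = 1) (hsurj : W.HasSurjectiveModNGaloisRep 3)
    (W' : WeierstrassCurve ℚ) [W'.IsElliptic] [W'.IsGloballyMinimal]
    (hcong : O6.ModPCongruent W' W 3) (hW'ss : ¬ Addv W' 3)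
    (hI' : ∀ (N' : ℕ) [NeZero N'] (K : Type) [Field K] [NumberField K]
      (Dt' : ModularParametrizationData W' N'), W'.conductorNorm ℤ = N' → IsImaginaryQuadratic K →
      SatisfiesHeegnerHypothesis N' K → Odd (NumberField.discr K) →
      ∀ (κ : ZpExtension K 3), κ.IsAnticyclotomic →
      ∀ (γ : absoluteGaloisGroup K) [Fact (κ.IsTopGenerator γ)] (𝔭 : HeightOneSpectrum (𝓞 K)),
        ((3 : ℕ) : 𝓞 K) ∈ 𝔭.asIdeal → 𝔭.asIdeal.ramificationIdx (𝓞 ℚ) = 1 →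
        𝔭.asIdeal.inertiaDeg (𝓞 ℚ) = 1 →
      ∀ (𝔭' : HeightOneSpectrum (𝓞 K)), ((3 : ℕ) : 𝓞 K) ∈ 𝔭'.asIdeal → 𝔭' ≠ 𝔭 →
      ∀ (ι' : PadicAlgCl 3 ≃+* ℂ), SchneiderFree.BranchInducesPrime 3 ι' 𝔭 →
        ∃ (ΩK : ℂ) (Ωp : ℂ_[3]) (L' : UnrSeries 3), ΩK ≠ 0 ∧ Ωp ≠ 0 ∧
          IsBDPLFunction ι' 𝔭 κ γ Dt'.f ΩK Ωp L' ∧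
          (Module.IsTorsion (IwasawaAlgebra 3) (XAc (W'.baseChange K) 3 κ 𝔭' ∅ γ) →
            ∀ (g : UnrSeries 3) (n m : ℕ),
              (XAc.charIdeal (W'.baseChange K) 3 κ 𝔭' ∅ γ).map (PowerSeries.map (toUnr 3)) = Ideal.span {g} →
              (∀ i < n, ‖((PowerSeries.coeff i g : unrIntegers 3) : ℂ_[3])‖ < 1) ∧
                  ‖((PowerSeries.coeff n g : unrIntegers 3) : ℂ_[3])‖ = 1 →
              (∀ i < m, ‖((PowerSeries.coeff i L' : unrIntegers 3) : ℂ_[3])‖ < 1) ∧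
                  ‖((PowerSeries.coeff m L' : unrIntegers 3) : ℂ_[3])‖ = 1 →
              m ≤ n)) :
    BSDp W 3 := by
  -- adapted from `bsdp_three_of_twinWanFrameAtT_odd_of_defectPT` (w2 g3 ← p609468 utd-p1 g11); the ONE change is `heq` («deg»)
  obtain ⟨hGZ, hKo, hGZK, hmod, hmodP, -, hGZ73, hFH, hpar, hHP⟩ := hF
  haveI hN0 : NeZero (W.conductorNorm ℤ) := ⟨W.conductorNorm_pos_holds.ne'⟩
  haveI hN0' : NeZero (W'.conductorNorm ℤ) := ⟨W'.conductorNorm_pos_holds.ne'⟩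
  have hw : W.rootNumber = -1 := by
    rcases W.rootNumber_eq_one_or with h | h
    · exfalso
      have heven : Even W.analyticRank := (hpar W).mpr h
      rw [hr] at heven
      exact Nat.not_even_one heven
    · exact h
  obtain ⟨K, _, _, hK, -, hHN, hH2N', hLt⟩ :=
    hFH W hw (2 * W'.conductorNorm ℤ) (mul_ne_zero two_ne_zero hN0'.out) 0
  have hHN' : SatisfiesHeegnerHypothesis (W'.conductorNorm ℤ) K :=
    SatisfiesHeegnerHypothesis.of_dvd (dvd_mul_left _ 2) hH2N'
  have hodd : Odd (NumberField.discr K) := by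
    have h8 := Literature.SatisfiesHeegnerHypothesis.discr_emod_eight hK.1 hH2N' (dvd_mul_right 2 _)
    rw [Int.odd_iff]; omega
  have h3N : 3 ∣ W.conductorNorm ℤ :=
    (W.dvd_conductorNorm_iff_not_hasGoodReductionAtPrime 3).mpr (not_good_of_addv W 3 hO6.2.1)
  have hsplit : SplitsIn K 3 := hHN 3 Nat.prime_three h3N
  obtain ⟨P, Dt, H, ι, hP⟩ := hHP W K hK hHN
  have hL0 : W.entireLFunction 1 = 0 := entireLFunction_one_eq_zero_of_analyticRank_eq_one hr
  obtain ⟨-, hderiv⟩ := leadingLCoeff_eq_deriv_of_analyticRank_eq_one hr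
  have hLK : LDerivEK W K ≠ 0 := by
    rw [lDerivEK_eq_deriv_mul W K hmod hL0]; exact mul_ne_zero hderiv hLt
  have hnt : ¬ IsOfFinAddOrder P :=
    (lDerivEK_ne_zero_iff_not_isOfFinAddOrder W (W.conductorNorm ℤ) K (hGZ _ W K) hK hHN
      ⟨Dt, H, ι, hP⟩).mp hLK
  obtain ⟨hrk, hfin⟩ := hKo (W.conductorNorm ℤ) W K hK hHN ⟨Dt, H, ι, hP⟩ hnt
  obtain ⟨Dt'⟩ := hmodP W'
  obtain ⟨κ, γ, -, hκ, hγ, -⟩ := X11b.exists_anticyclotomic_generator_prime (p := 3) hK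
  haveI : Fact (κ.IsTopGenerator γ) := ⟨hγ⟩
  obtain ⟨𝔭, h𝔭, he, hf⟩ := X11b.exists_degreeOnePrime_of_splitsIn K 3 hK.1 hsplit
  obtain ⟨𝔭', hne, h𝔭', he', hf'⟩ := X11b.Three.exists_ne_degreeOne_prime hK.1 h𝔭 he hf
  obtain ⟨ι', hind, ΩK, Ωp, L, hΩK, hΩp, hBDP, u, hval⟩ :=
    hV W (W.conductorNorm ℤ) K Dt H ι P hO6 hsurj hr rfl hK hHN hodd hLt hP hnt κ hκ γ 𝔭 h𝔭 he hf
  -- «deg»: the twin's frame with its TORSION-CONDITIONAL DEGREE clause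
  have hdeg' := hI' (W'.conductorNorm ℤ) K Dt' rfl hK hHN' hodd κ hκ γ 𝔭 h𝔭 he hf 𝔭' h𝔭' hne ι' hind
  have hctl : SchneiderFree.AdditiveControlOnTreeAt 3 κ 𝔭' γ (embAt K 3 𝔭' h𝔭' he' hf') P :=
    hC W (W.conductorNorm ℤ) K Dt H ι P hO6 hsurj hr rfl hK hHN hLt hP hnt (hKo _ W K) κ hκ γ 𝔭'
      h𝔭' he' hf'
  obtain ⟨n, hn, hneq⟩ := hctl
  -- «act E»: the wild curve's base finiteness at every `v ∋ 3`, from rank-one data over `K`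
  have hfinE : ∀ (v : HeightOneSpectrum (𝓞 K)), ((3 : ℕ) : 𝓞 K) ∈ v.asIdeal →
      Finite (selmerAcBase (W.baseChange K) 3 v ∅) := by
    intro v hv
    haveI : Finite (W.baseChange K).sha := hfin
    have hSha3 : Finite (AddCommGroup.primaryComponent (W.baseChange K).sha 3) := inferInstance
    obtain ⟨he'', hf''⟩ := X11b.degreeOne_of_splitsIn hK.1 hsplit hv
    obtain ⟨hfinv, -⟩ :=
      SchneiderFreeAdditiveX3.natCard_selmerAcBase_mul_eq_of_rankOne_anyTorsion_shaPrimary W 3 K (hPT K)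
        (localEulerPoincareCharacteristicFact_proof K) hK hsplit hrk hSha3 P hnt v hv he'' hf''
    exact hfinv
  -- «deg»: ♭T′ → wall → μ squeeze in the DEGREE currency (§1): IMC EQUALITY for `E` at `L`
  have heq : (XAc.charIdeal (W.baseChange K) 3 κ 𝔭' ∅ γ).map (PowerSeries.map (toUnr 3)) =
      Ideal.span {L} :=
    charIdeal_eq_of_defectPT_of_wall_of_mu_degreeConditional W W' (W.conductorNorm ℤ) (W'.conductorNorm ℤ) K Dt Dt'
      hD hwall hmu hPT hPT2 hO6 hsurj hr rfl hcong hW'ss rfl hK hHN hHN' hfinE κ hκ γ 𝔭 h𝔭 he hf 𝔭' h𝔭' hne ι' hind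
      hn.1 hdeg' hΩK hΩp hBDP
  have hval' : L.HasValueAt 0 ((((u : unrIntegers 3) : unrIntegers 3) : ℂ_[3]) *
      (algebraMap ℚ_[3] ℂ_[3]
        (logOmega W 3 (embAt K 3 𝔭' h𝔭' he' hf') P / (Dt.c : ℚ_[3]))) ^ 2) :=
    (SchneiderFreeAdditiveX3.hasValueAt_sq_logOmega_embAt_iff_of_rank_one W 3 hK.1 hrk h𝔭 he hf
      h𝔭' he' hf' P _ _ L).mpr hval
  have hc0 : Dt.c ≠ 0 := Dt.maninConstant_ne_zero_holds
  have hlog : logOmega W 3 (embAt K 3 𝔭' h𝔭' he' hf') P ≠ 0 := X11b.R1.logOmega_ne_zero W 3 _ hnt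
  have hlow : SchneiderFree.AdditiveIMCLowerBDPOnTreeLeAt 3 κ 𝔭' γ (embAt K 3 𝔭' h𝔭' he' hf')
      (padicValNat 3 Dt.c.natAbs) P := by
    obtain ⟨htors, f, hfI, hf0, hfn⟩ := hn
    have hmem : PowerSeries.map (toUnr 3) f ∈ Ideal.span {L} := by
      have h3 := heq.le
      rw [hfI, CongruenceLimit.map_span_singleton_powerSeries] at h3
      exact (Ideal.span_singleton_le_iff_mem _).mp h3
    obtain ⟨-, hle⟩ := Supersingular.two_mul_valuation_le_of_mem_span 3 hf0 hmem u hval'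
    have hc0' : (Dt.c : ℚ_[3]) ≠ 0 := by exact_mod_cast hc0
    rw [div_eq_mul_inv, Padic.valuation_mul hlog (inv_ne_zero hc0'), Padic.valuation_inv,
      Padic.valuation_intCast, valuation_logOmega hlog, hfn] at hle
    refine ⟨n, ⟨htors, f, hfI, hf0, hfn⟩, ?_⟩
    simp only [padicValInt] at hle
    linarith
  have hup : SchneiderFree.Upper.AdditiveIMCUpperBDPOnTreeLeAt 3 κ 𝔭' γ (embAt K 3 𝔭' h𝔭' he' hf')
      (padicValNat 3 Dt.c.natAbs) P :=
    SchneiderFree.Upper.additiveIMCUpperBDPOnTreeLeAt_of_value_of_dvd' hn heq.ge u hc0 hlog hval'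
  have hlo : SchneiderFree.IndexLowerBoundLeAt W 3 K P (padicValNat 3 Dt.c.natAbs) :=
    SchneiderFreeAdditiveX3.indexLowerBoundLeAt_of_imcLowerLe_of_control rfl hK hHN hfin hlow
      ⟨n, hn, hneq⟩
  have hupI : SchneiderFree.Upper.IndexUpperBoundLeAt W 3 K P (padicValNat 3 Dt.c.natAbs) :=
    SchneiderFree.Upper.indexUpperBoundLeAt_of_imcUpperLe_of_control rfl hK hHN hfin hup ⟨n, hn, hneq⟩
  have hD0 : (NumberField.discr K : ℚ) ≠ 0 := by exact_mod_cast NumberField.discr_ne_zero K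
  haveI : (W.quadraticTwist (NumberField.discr K : ℚ)).IsElliptic := W.isElliptic_quadraticTwist hD0
  obtain ⟨Cd, hCd⟩ := hasGlobalMinimalModel_rat_holds (W.quadraticTwist (NumberField.discr K : ℚ))
  haveI : (Cd • W.quadraticTwist (NumberField.discr K : ℚ)).IsGloballyMinimal := hCd
  exact SchneiderFree.Exact.bsdp_three_of_exactIndexManin_of_wAllExclAddWildRankZero hGZ hKo hGZK hmod
    hGZ73 hZ W hO6 hsurj hr (W.conductorNorm ℤ) K Dt H ι P
    (Cd • W.quadraticTwist (NumberField.discr K : ℚ)) rfl hK hodd hHN hLt hP ⟨Cd, rfl⟩ hlo hupI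

end Summit.BirchSwinnertonDyer.BirchSwinnertonDyer.Theorems.UniversalToricDescentKernelDegreeOnlyTwin

end
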